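import Summits.CriticalPhenomena.Ising3DConformalLimit.Theorems.PerfectScreeningSubharmonicOffOriginKlBandDefs
import Literature.Probability.LatticeModels.AxisSpectralRepresentationProofs

/-!
# Crux `PerfectScreening.SubharmonicOffOrigin` (stmt-CriticalPhenomena-1341), line
`kl-band-positivity`: helper 2/2 of stub `stub_jointSpectralMeasure` — the weak limit of joint
spectral measures (moment data in `λ`, Fourier data in `k`)

Registered sub-goal `jointSpec_limit` (supports stmt-CriticalPhenomena-1341), pure measure theory:
let `ν_j` be finite positive measures on `ℝ × ℝ^{d'}` carried by `[0,∞) × [0,2π]^{d'}` whose joint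
test integrals `∫ λⁿ cos(k·y) dν_j` converge to `u(n,y)` for every `n ∈ ℕ`, `y ∈ ℤ^{d'}`, whose
`λ`-moments of order `n ≤ j` are `≤ 1`, and which charge `[0,δ] × ℝ^{d'}` by at most `B δ²` uniformly
in `j`.  Then there is a finite positive measure `μ` carried by `(0,1] × ℝ^{d'}` with
`u(n,y) = ∫ λⁿ cos(k·y) dμ` for ALL `n, y` (including `n = 0`).

This is Part D of the tree's axis file `AxisSpectralRepresentationProofs.lean`
(`AxisSpectral.exists_laplace_of_momentLimit`, "the moment criterion for the convergence of
positive measures over bounded intervals" of Aizenman–Duminil-Copin 2021, App. §8.3, proof of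
Prop. 8.6) with the compact interval `[0,2]` replaced by the compact box `[0,2] × [0,2π]^{d'}`:
restrict to the box (the tails in `λ > 2` are `≤ 2^{n-j}`), take a weak cluster point (Mathlib's
`isCompact_setOf_finiteMeasure_le_of_isCompact`), read off the joint test integrals through bounded
continuous representatives (`AxisSpectral.exists_bcf_eq_pow` times the bounded continuous
`cos(k·y)`), kill `λ ∈ (1,2]` with the moment bound and the atom `λ = 0` with the uniform bound
(`AxisSpectral.exists_bcf_tent`).  No change of variables (the window is stated in `λ`).

References: M. Aizenman, H. Duminil-Copin, Ann. of Math. 194 (2021) = arXiv:1912.07973, App. §8.3;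
Mathlib `MeasureTheory.Measure.Prokhorov`, `FiniteMeasure.continuous_integral_boundedContinuousFunction`.
-/

noncomputable section

open MeasureTheory ProbabilityTheory
open Literature.Probability.LatticeModels

namespace Summit.CriticalPhenomena.Ising3DConformalLimit.Theorems.PerfectScreening.KlBand

open Filter Set BoundedContinuousFunction
open scoped Topology

/-- A bounded continuous function on `ℝ × ℝ^{d'}` agreeing with `λⁿ cos(k·y)` on `[0,2] × ℝ^{d'}`. -/
theorem jointSpec_exists_bcf_test {d' : ℕ} (n : ℕ) (y : Fin d' → ℤ) :
    ∃ g : (ℝ × (Fin d' → ℝ)) →ᵇ ℝ, ∀ p : ℝ × (Fin d' → ℝ), p.1 ∈ Icc (0 : ℝ) 2 →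
      g p = p.1 ^ n * Real.cos (∑ i, p.2 i * (y i : ℝ)) := by
  refine ⟨BoundedContinuousFunction.ofNormedAddCommGroup
    (fun p : ℝ × (Fin d' → ℝ) => (max 0 (min p.1 2)) ^ n * Real.cos (∑ i, p.2 i * (y i : ℝ)))
    (by fun_prop) (2 ^ n) fun p => ?_, fun p hp => ?_⟩
  · have h0 : 0 ≤ max 0 (min p.1 2) := le_max_left _ _
    have h2 : max 0 (min p.1 2) ≤ 2 := max_le (by norm_num) (min_le_right _ _)
    rw [Real.norm_eq_abs, abs_mul, abs_pow, abs_of_nonneg h0]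
    calc max 0 (min p.1 2) ^ n * |Real.cos (∑ i, p.2 i * (y i : ℝ))| ≤ 2 ^ n * 1 :=
          mul_le_mul (pow_le_pow_left₀ h0 h2 n) (Real.abs_cos_le_one _) (abs_nonneg _) (by positivity)
      _ = 2 ^ n := mul_one _
  · simp only [BoundedContinuousFunction.coe_ofNormedAddCommGroup]
    rw [min_eq_left hp.2, max_eq_right hp.1]

/-- **The weak limit of joint spectral measures** (registered sub-goal `jointSpec_limit` of
stmt-CriticalPhenomena-1341): from finite positive measures `ν_j` on `ℝ × ℝ^{d'}` carried by
`[0,∞) × [0,2π]^{d'}`, with convergent joint test integrals `∫ λⁿcos(k·y) dν_j → u(n,y)`, `λ`-moments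
of order `n ≤ j` at most `1`, and `ν_j([0,δ] × ℝ^{d'}) ≤ Bδ²`, to a finite positive measure `μ`
carried by `(0,1] × ℝ^{d'}` with `u(n,y) = ∫ λⁿ cos(k·y) dμ` for all `n, y`. -/
theorem jointSpec_limit :
    ∀ {d' : ℕ} (u : ℕ → (Fin d' → ℤ) → ℝ) (ν : ℕ → Measure (ℝ × (Fin d' → ℝ))),
      (∀ j, IsFiniteMeasure (ν j)) → ∀ {B : ℝ}, 0 ≤ B →
      (∀ j, ν j (Set.Ici (0 : ℝ) ×ˢ Set.Icc (0 : Fin d' → ℝ) (fun _ => 2 * Real.pi))ᶜ = 0) →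
      (∀ j (n : ℕ) (y : Fin d' → ℤ),
        Integrable (fun p : ℝ × (Fin d' → ℝ) => p.1 ^ n * Real.cos (∑ i, p.2 i * (y i : ℝ))) (ν j)) →
      (∀ j (n : ℕ), Integrable (fun p : ℝ × (Fin d' → ℝ) => p.1 ^ n) (ν j)) →
      (∀ j n, n ≤ j → ∫ p, p.1 ^ n ∂(ν j) ≤ 1) →
      (∀ n y, Tendsto (fun j => ∫ p, p.1 ^ n * Real.cos (∑ i, p.2 i * (y i : ℝ)) ∂(ν j)) atTop
        (𝓝 (u n y))) →
      (∀ j δ, 0 ≤ δ → ν j (Set.Icc 0 δ ×ˢ Set.univ) ≤ ENNReal.ofReal (B * δ ^ 2)) →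
      ∃ μ : Measure (ℝ × (Fin d' → ℝ)), IsFiniteMeasure μ ∧ μ (Set.Ioc (0 : ℝ) 1 ×ˢ Set.univ)ᶜ = 0 ∧
        ∀ n y, u n y = ∫ p, p.1 ^ n * Real.cos (∑ i, p.2 i * (y i : ℝ)) ∂μ := by
  intro d' u ν hfin B hB hsupp hintT hint hle hlim hzero
  classical
  set Kb : Set (Fin d' → ℝ) := Icc (0 : Fin d' → ℝ) (fun _ => 2 * Real.pi) with hKbdef
  set K : Set (ℝ × (Fin d' → ℝ)) := Icc (0 : ℝ) 2 ×ˢ Kb with hKdef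
  have hK : IsCompact K := isCompact_Icc.prod isCompact_Icc
  have hKm : MeasurableSet K := measurableSet_Icc.prod measurableSet_Icc
  have hae0 : ∀ j, ∀ᵐ p ∂(ν j), 0 ≤ p.1 ∧ p.2 ∈ Kb := fun j =>
    (measure_eq_zero_iff_ae_notMem.1 (hsupp j)).mono fun p hp => by
      have hp' : p ∈ Ici (0 : ℝ) ×ˢ Kb := of_not_not hp
      exact ⟨hp'.1, hp'.2⟩
  /- Step 1: tails beyond `λ = 2` and truncated test integrals. -/
  have htail : ∀ n j, n ≤ j → ∫ p in Kᶜ, p.1 ^ n ∂(ν j) ≤ (1 / 2) ^ (j - n) ∧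
      ∀ y : Fin d' → ℤ, |∫ p in Kᶜ, p.1 ^ n * Real.cos (∑ i, p.2 i * (y i : ℝ)) ∂(ν j)| ≤
        ∫ p in Kᶜ, p.1 ^ n ∂(ν j) := by
    intro n j hnj
    haveI := hfin j
    have haeK : ∀ᵐ p ∂(ν j).restrict Kᶜ, 2 < p.1 := by
      filter_upwards [ae_restrict_mem hKm.compl, ae_restrict_of_ae (hae0 j)] with p hp hp0
      simp only [hKdef, mem_compl_iff, mem_prod, mem_Icc, not_and_or, not_le] at hp
      rcases hp with (hp | hp) | hp
      · exact absurd hp0.1 (not_le.2 hp)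
      · exact hp
      · exact absurd hp0.2 hp
    have hpt : ∀ x : ℝ, 2 < x → x ^ n ≤ x ^ j * (1 / 2) ^ (j - n) := by
      intro x hx
      have hx0 : 0 ≤ x := by linarith
      have h2 : (2 : ℝ) ^ (j - n) ≤ x ^ (j - n) := pow_le_pow_left₀ (by norm_num) hx.le _
      have hxj : x ^ j = x ^ n * x ^ (j - n) := by rw [← pow_add]; congr 1; omega
      rw [hxj, one_div_pow, mul_one_div, le_div_iff₀ (pow_pos (by norm_num : (0 : ℝ) < 2) _)]
      exact mul_le_mul_of_nonneg_left h2 (pow_nonneg hx0 n)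
    constructor
    · calc ∫ p in Kᶜ, p.1 ^ n ∂(ν j) ≤ ∫ p in Kᶜ, p.1 ^ j * (1 / 2) ^ (j - n) ∂(ν j) :=
            integral_mono_ae (hint j n).integrableOn ((hint j j).mul_const _).integrableOn
              (haeK.mono fun p hp => hpt p.1 hp)
        _ = (∫ p in Kᶜ, p.1 ^ j ∂(ν j)) * (1 / 2) ^ (j - n) := integral_mul_const _ _
        _ ≤ (∫ p, p.1 ^ j ∂(ν j)) * (1 / 2) ^ (j - n) := by
            refine mul_le_mul_of_nonneg_right ?_ (pow_nonneg (by norm_num) _)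
            exact setIntegral_le_integral (hint j j) ((hae0 j).mono fun p hp => pow_nonneg hp.1 j)
        _ ≤ 1 * (1 / 2) ^ (j - n) := mul_le_mul_of_nonneg_right (hle j j le_rfl) (pow_nonneg (by norm_num) _)
        _ = (1 / 2) ^ (j - n) := one_mul _
    · intro y
      calc |∫ p in Kᶜ, p.1 ^ n * Real.cos (∑ i, p.2 i * (y i : ℝ)) ∂(ν j)|
          ≤ ∫ p in Kᶜ, |p.1 ^ n * Real.cos (∑ i, p.2 i * (y i : ℝ))| ∂(ν j) := abs_integral_le_integral_abs
        _ ≤ ∫ p in Kᶜ, p.1 ^ n ∂(ν j) := by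
            refine integral_mono_ae (hintT j n y).integrableOn.abs (hint j n).integrableOn
              (haeK.mono fun p hp => ?_)
            have hp0 : 0 ≤ p.1 ^ n := pow_nonneg (by linarith) n
            show |p.1 ^ n * Real.cos (∑ i, p.2 i * (y i : ℝ))| ≤ p.1 ^ n
            rw [abs_mul, abs_of_nonneg hp0]
            exact mul_le_of_le_one_right hp0 (Real.abs_cos_le_one _)
  have hgeom : ∀ n, Tendsto (fun j : ℕ => (1 / 2 : ℝ) ^ (j - n)) atTop (𝓝 0) := fun n =>
    (tendsto_pow_atTop_nhds_zero_of_lt_one (by norm_num) (by norm_num)).comp (tendsto_sub_atTop_nat n)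
  have htrunc : ∀ n y, Tendsto (fun j => ∫ p in K, p.1 ^ n * Real.cos (∑ i, p.2 i * (y i : ℝ)) ∂(ν j))
      atTop (𝓝 (u n y)) := by
    intro n y
    have hsplit : ∀ j, ∫ p in K, p.1 ^ n * Real.cos (∑ i, p.2 i * (y i : ℝ)) ∂(ν j) =
        ∫ p, p.1 ^ n * Real.cos (∑ i, p.2 i * (y i : ℝ)) ∂(ν j) -
          ∫ p in Kᶜ, p.1 ^ n * Real.cos (∑ i, p.2 i * (y i : ℝ)) ∂(ν j) := by
      intro j
      rw [← integral_add_compl hKm (hintT j n y)]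
      ring
    simp_rw [hsplit]
    rw [← sub_zero (u n y)]
    refine (hlim n y).sub (squeeze_zero_norm' ?_ (hgeom n))
    exact eventually_atTop.2 ⟨n, fun j hj => by
      rw [Real.norm_eq_abs]; exact ((htail n j hj).2 y).trans (htail n j hj).1⟩
  /- Step 2: a weak cluster point of the restrictions to `K`. -/
  let ρ : ℕ → FiniteMeasure (ℝ × (Fin d' → ℝ)) := fun j => ⟨(ν j).restrict K, by haveI := hfin j; infer_instance⟩
  have hρcoe : ∀ j, ((ρ j : FiniteMeasure (ℝ × (Fin d' → ℝ))) : Measure (ℝ × (Fin d' → ℝ))) = (ν j).restrict K :=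
    fun j => rfl
  set S : Set (FiniteMeasure (ℝ × (Fin d' → ℝ))) := {μ | μ.mass ≤ 1 ∧ μ Kᶜ = 0} with hSdef
  have hS : IsCompact S := isCompact_setOf_finiteMeasure_le_of_isCompact 1 hK
  have hρS : ∀ j, ρ j ∈ S := by
    intro j
    haveI := hfin j
    constructor
    · have h1 : (ν j) univ ≤ 1 := by
        have h := hle j 0 (Nat.zero_le j)
        simp only [pow_zero, integral_const, smul_eq_mul, mul_one] at h
        have : (ν j) univ = ENNReal.ofReal ((ν j).real univ) := (ofReal_measureReal (by finiteness)).symm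
        rw [this]
        exact ENNReal.ofReal_le_one.2 h
      have h2 : ((ρ j : FiniteMeasure (ℝ × (Fin d' → ℝ))) : Measure (ℝ × (Fin d' → ℝ))) univ ≤ 1 := by
        rw [hρcoe, Measure.restrict_apply MeasurableSet.univ, univ_inter]
        exact (measure_mono (subset_univ _)).trans h1
      have h3 : ((ρ j).mass : ENNReal) ≤ 1 := by rw [FiniteMeasure.ennreal_mass]; exact h2
      exact_mod_cast h3
    · rw [FiniteMeasure.null_iff_toMeasure_null, hρcoe, Measure.restrict_apply hKm.compl, compl_inter_self,
        measure_empty]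
  have hleS : (atTop : Filter ℕ).map ρ ≤ 𝓟 S :=
    le_principal_iff.2 (mem_map.2 (univ_mem' fun j => hρS j))
  obtain ⟨νbar, hνbarS, hclu⟩ := hS.exists_clusterPt hleS
  have hclu' : MapClusterPt νbar atTop ρ := hclu
  set μb : Measure (ℝ × (Fin d' → ℝ)) := (νbar : Measure (ℝ × (Fin d' → ℝ))) with hμb
  have hμbK : μb Kᶜ = 0 := (FiniteMeasure.null_iff_toMeasure_null νbar Kᶜ).1 hνbarS.2
  have haeK : ∀ᵐ p ∂μb, p ∈ K := by
    have := measure_eq_zero_iff_ae_notMem.1 hμbK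
    exact this.mono fun p hp => of_not_not hp
  /- Step 3: integrals of bounded continuous functions along the cluster point. -/
  have hcluInt : ∀ g : (ℝ × (Fin d' → ℝ)) →ᵇ ℝ,
      MapClusterPt (∫ p, g p ∂μb) atTop (fun j => ∫ p, g p ∂(ρ j : Measure (ℝ × (Fin d' → ℝ)))) := by
    intro g
    have hcont : Continuous fun μ : FiniteMeasure (ℝ × (Fin d' → ℝ)) => ∫ p, g p ∂(μ : Measure _) :=
      FiniteMeasure.continuous_integral_boundedContinuousFunction g
    exact hclu'.tendsto_comp (hcont.tendsto νbar)
  -- the joint test integrals of the cluster point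
  have hmomK : ∀ n y, ∫ p, p.1 ^ n * Real.cos (∑ i, p.2 i * (y i : ℝ)) ∂μb = u n y := by
    intro n y
    obtain ⟨g, hg⟩ := jointSpec_exists_bcf_test n y
    have h1 : ∀ j, ∫ p, g p ∂(ρ j : Measure (ℝ × (Fin d' → ℝ))) =
        ∫ p in K, p.1 ^ n * Real.cos (∑ i, p.2 i * (y i : ℝ)) ∂(ν j) := by
      intro j
      rw [hρcoe]
      exact setIntegral_congr_fun hKm fun p hp => hg p hp.1
    have h2 : ∫ p, g p ∂μb = u n y := by
      refine AxisSpectral.eq_of_mapClusterPt_of_tendsto (hcluInt g) ?_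
      simp_rw [h1]
      exact htrunc n y
    rw [← h2]
    exact integral_congr_ae (haeK.mono fun p hp => (hg p hp.1).symm)
  -- the `λ`-moments of the cluster point are at most `1`
  have hpowK : ∀ n, Integrable (fun p : ℝ × (Fin d' → ℝ) => p.1 ^ n) μb ∧ ∫ p, p.1 ^ n ∂μb ≤ 1 := by
    intro n
    obtain ⟨g₁, hg₁⟩ := AxisSpectral.exists_bcf_eq_pow n
    set g : (ℝ × (Fin d' → ℝ)) →ᵇ ℝ := g₁.compContinuous ⟨Prod.fst, continuous_fst⟩ with hgdef
    have hg : ∀ p : ℝ × (Fin d' → ℝ), p.1 ∈ Icc (0 : ℝ) 2 → g p = p.1 ^ n := fun p hp => hg₁ p.1 hp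
    have hgK : (fun p => g p) =ᵐ[μb] fun p => p.1 ^ n := haeK.mono fun p hp => hg p hp.1
    refine ⟨(g.integrable μb).congr hgK, ?_⟩
    rw [← integral_congr_ae hgK]
    refine isClosed_Iic.mem_of_mapClusterPt (hcluInt g) (eventually_atTop.2 ⟨n, fun j hj => ?_⟩)
    haveI := hfin j
    show ∫ p, g p ∂(ρ j : Measure (ℝ × (Fin d' → ℝ))) ≤ 1
    rw [hρcoe, setIntegral_congr_fun hKm fun p hp => hg p hp.1]
    exact (setIntegral_le_integral (hint j n) ((hae0 j).mono fun p hp => pow_nonneg hp.1 n)).trans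
      (hle j n hj)
  -- the atom at `λ = 0`
  have hzero_b : μb ({(0 : ℝ)} ×ˢ (univ : Set (Fin d' → ℝ))) = 0 := by
    have hm0 : MeasurableSet ({(0 : ℝ)} ×ˢ (univ : Set (Fin d' → ℝ))) :=
      (measurableSet_singleton 0).prod MeasurableSet.univ
    have hδ : ∀ δ : ℝ, 0 < δ → μb.real ({(0 : ℝ)} ×ˢ univ) ≤ B * δ ^ 2 := by
      intro δ hδ
      obtain ⟨g₁, hg₁⟩ := AxisSpectral.exists_bcf_tent hδ
      set g : (ℝ × (Fin d' → ℝ)) →ᵇ ℝ := g₁.compContinuous ⟨Prod.fst, continuous_fst⟩ with hgdef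
      have hgl : ∀ p : ℝ × (Fin d' → ℝ), ({(0 : ℝ)} ×ˢ (univ : Set (Fin d' → ℝ))).indicator 1 p ≤ g p := by
        intro p
        refine le_trans (le_of_eq ?_) (hg₁ p.1).1
        by_cases hp : p.1 = 0
        · rw [indicator_of_mem (show p ∈ ({(0 : ℝ)} ×ˢ (univ : Set (Fin d' → ℝ))) from ⟨hp, mem_univ _⟩),
            indicator_of_mem (show p.1 ∈ ({0} : Set ℝ) from hp)]
          rfl
        · rw [indicator_of_notMem (fun h : p ∈ ({(0 : ℝ)} ×ˢ (univ : Set (Fin d' → ℝ))) => hp h.1),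
            indicator_of_notMem (show p.1 ∉ ({0} : Set ℝ) from hp)]
      have hgu : ∀ p : ℝ × (Fin d' → ℝ), g p ≤ (Icc (-δ) δ ×ˢ (univ : Set (Fin d' → ℝ))).indicator 1 p := by
        intro p
        refine le_trans (hg₁ p.1).2 (le_of_eq ?_)
        by_cases hp : p.1 ∈ Icc (-δ) δ
        · rw [indicator_of_mem hp, indicator_of_mem (show p ∈ Icc (-δ) δ ×ˢ (univ : Set (Fin d' → ℝ))
            from ⟨hp, mem_univ _⟩)]
          rfl
        · rw [indicator_of_notMem hp,
            indicator_of_notMem (fun h : p ∈ Icc (-δ) δ ×ˢ (univ : Set (Fin d' → ℝ)) => hp h.1)]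
      have h1 : ∀ j, ∫ p, g p ∂(ρ j : Measure (ℝ × (Fin d' → ℝ))) ≤ B * δ ^ 2 := by
        intro j
        haveI := hfin j
        calc ∫ p, g p ∂(ρ j : Measure (ℝ × (Fin d' → ℝ)))
            ≤ ∫ p, (Icc (-δ) δ ×ˢ (univ : Set (Fin d' → ℝ))).indicator 1 p ∂(ρ j : Measure (ℝ × (Fin d' → ℝ))) :=
              integral_mono (g.integrable _) ((integrable_const 1).indicator (measurableSet_Icc.prod MeasurableSet.univ))
                hgu
          _ = ((ρ j : Measure (ℝ × (Fin d' → ℝ)))).real (Icc (-δ) δ ×ˢ univ) :=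
              integral_indicator_one (measurableSet_Icc.prod MeasurableSet.univ)
          _ = (ν j).real (Icc (-δ) δ ×ˢ univ ∩ K) := by
              rw [hρcoe, measureReal_restrict_apply (measurableSet_Icc.prod MeasurableSet.univ)]
          _ ≤ (ν j).real (Icc 0 δ ×ˢ univ) := by
              refine measureReal_mono (fun p hp => ?_)
              simp only [hKdef, mem_inter_iff, mem_prod, mem_Icc, mem_univ, and_true] at hp
              exact ⟨⟨hp.2.1.1, hp.1.2⟩, mem_univ _⟩
          _ ≤ B * δ ^ 2 := by
              rw [measureReal_def]
              exact ENNReal.toReal_le_of_le_ofReal (by positivity) (hzero j δ hδ.le)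
      have h2 : ∫ p, g p ∂μb ≤ B * δ ^ 2 := AxisSpectral.le_of_mapClusterPt_of_le (hcluInt g) h1
      calc μb.real ({(0 : ℝ)} ×ˢ univ) = ∫ p, ({(0 : ℝ)} ×ˢ (univ : Set (Fin d' → ℝ))).indicator 1 p ∂μb :=
            (integral_indicator_one hm0).symm
        _ ≤ ∫ p, g p ∂μb := integral_mono ((integrable_const 1).indicator hm0) (g.integrable _) hgl
        _ ≤ B * δ ^ 2 := h2
    have hlimδ : Tendsto (fun k : ℕ => B * (1 / ((k : ℝ) + 1)) ^ 2) atTop (𝓝 0) := by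
      have h : Tendsto (fun k : ℕ => 1 / ((k : ℝ) + 1)) atTop (𝓝 0) := tendsto_one_div_add_atTop_nhds_zero_nat
      simpa using (h.pow 2).const_mul B
    have hle0 : μb.real ({(0 : ℝ)} ×ˢ univ) ≤ 0 :=
      ge_of_tendsto hlimδ (Eventually.of_forall fun k => hδ _ (by positivity))
    exact (measureReal_eq_zero_iff (by finiteness)).1 (le_antisymm hle0 measureReal_nonneg)
  -- no mass above `λ = 1`
  have hone_b : μb (Ioi (1 : ℝ) ×ˢ (univ : Set (Fin d' → ℝ))) = 0 := by
    have hc : ∀ c : ℝ, 1 < c → μb (Ioi c ×ˢ (univ : Set (Fin d' → ℝ))) = 0 := by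
      intro c hc
      have hc0 : 0 ≤ c := by linarith
      have hmc : MeasurableSet (Ioi c ×ˢ (univ : Set (Fin d' → ℝ))) := measurableSet_Ioi.prod MeasurableSet.univ
      have hbound : ∀ n : ℕ, μb.real (Ioi c ×ˢ univ) ≤ (1 / c) ^ n := by
        intro n
        have h1 : c ^ n * μb.real (Ioi c ×ˢ univ) ≤ 1 := by
          calc c ^ n * μb.real (Ioi c ×ˢ univ)
              = ∫ p, (Ioi c ×ˢ (univ : Set (Fin d' → ℝ))).indicator (fun _ => c ^ n) p ∂μb := by
                rw [integral_indicator_const _ hmc, smul_eq_mul, mul_comm]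
            _ ≤ ∫ p, p.1 ^ n ∂μb := by
                refine integral_mono_ae ((integrable_const _).indicator hmc) (hpowK n).1 ?_
                filter_upwards [haeK] with p hp
                by_cases hpc : p ∈ Ioi c ×ˢ (univ : Set (Fin d' → ℝ))
                · rw [indicator_of_mem hpc]
                  exact pow_le_pow_left₀ hc0 (le_of_lt hpc.1) n
                · rw [indicator_of_notMem hpc]
                  exact pow_nonneg hp.1.1 n
            _ ≤ 1 := (hpowK n).2
        rw [one_div_pow, le_div_iff₀ (pow_pos (by linarith) n), mul_comm]
        exact h1
      have hlim0 : Tendsto (fun n : ℕ => (1 / c) ^ n) atTop (𝓝 0) :=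
        tendsto_pow_atTop_nhds_zero_of_lt_one (by positivity) ((div_lt_one (by linarith)).2 hc)
      have hle0 : μb.real (Ioi c ×ˢ univ) ≤ 0 := ge_of_tendsto hlim0 (Eventually.of_forall hbound)
      exact (measureReal_eq_zero_iff (by finiteness)).1 (le_antisymm hle0 measureReal_nonneg)
    have hcover : Ioi (1 : ℝ) ×ˢ (univ : Set (Fin d' → ℝ)) ⊆ ⋃ m : ℕ, Ioi (1 + 1 / ((m : ℝ) + 1)) ×ˢ univ := by
      intro p hp
      obtain ⟨m, hm⟩ := exists_nat_one_div_lt (sub_pos.2 (mem_Ioi.1 hp.1))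
      exact mem_iUnion.2 ⟨m, ⟨by rw [mem_Ioi]; linarith, mem_univ _⟩⟩
    refine measure_mono_null hcover (measure_iUnion_null fun m => hc _ ?_)
    have : 0 < 1 / ((m : ℝ) + 1) := by positivity
    linarith
  /- Step 4: conclusion. -/
  refine ⟨μb, inferInstance, ?_, fun n y => (hmomK n y).symm⟩
  refine measure_mono_null (fun p hp => ?_) (measure_union_null (measure_union_null hμbK hzero_b) hone_b)
  simp only [mem_compl_iff, mem_prod, mem_Ioc, mem_univ, and_true, not_and_or, not_lt, not_le] at hp
  simp only [hKdef, mem_union, mem_compl_iff, mem_prod, mem_Icc, mem_singleton_iff, mem_Ioi, mem_univ,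
    and_true, not_and_or, not_le]
  rcases hp with hp | hp
  · rcases hp.lt_or_eq with hp | hp
    · exact Or.inl (Or.inl (Or.inl (Or.inl hp)))
    · exact Or.inl (Or.inr hp)
  · exact Or.inr hp

end Summit.CriticalPhenomena.Ising3DConformalLimit.Theorems.PerfectScreening.KlBand

end
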